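import Literature.Analysis.FluidPDE.DynamicRescalingVelocityRate
import Literature.Analysis.FluidPDE.KNSSPoloidalAxisDecay
import HarnessLib

/-!
# The circulation clock and the rescaled viscosity of a dynamic rescaling with DRIFTING
# exponents whose ratio is pinned on one side of `½`

Topic `Literature/Analysis/FluidPDE`; second half of `DynamicRescalingVelocityRate.lean` (length
and velocity clocks, Leray's rate), in the same setting and notation: continuous exponents
`c_u, c_l`, time clock `C_u = rescalingFactor c_u` (`t′(τ) = C_u`, `t = rescaledTime C_u`,
`T = blowupTime C_u`), length clock `C_l = rescalingFactor (−c_l)`, ratio `ĉ_l = c_l/|c_u|`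
pinned above `γ` (`γ (−c_u) ≤ c_l` on `[0, ∞)`) or below `γ′` (`c_l ≤ γ′ (−c_u)`). The
EXACT-ansatz versions of everything here are in `SelfSimilarCollapseAnsatz.lean`
(`swirl_selfSimilarCollapse`, `swirl_unbounded_of_lt_half`, `effectiveViscosity`,
`tendsto_effectiveViscosity_atTop_of_half_lt` / `_zero_of_lt_half`, `effectiveViscosity_half`).

## The dictionary (Hou 2026 §3, pp. 10–11 of the held text)

With `ũ₁(τ, ξ, η) = C_u(τ) u₁(t(τ), C_l ξ, C_l η)` and `Γ = r² u₁ = r u^θ` the rescaled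
circulation is `Γ̃ = ξ² ũ₁ = (C_u/C_l²) Γ`, and the rescaled viscosity multiplying `Δ̃` in the
rescaled equations is `ν̃ = ν C_ψ/C_l = ν C_u/C_l²` (`C_ψ = C_u/C_l`; Hou p. 11:
"`ν C_ψ/C_{lz} = ν₀`", the identification of his solution-dependent viscosity with a constant
rescaled one). For a CONSTANT ratio `ĉ_l` these are `(T−t)^{2ĉ_l−1} Γ̃`-scalings and
`ν̃ = ν (T−t)^{1−2ĉ_l}` (the tree's `effectiveViscosity`).

## What is proved (all `theorem`s; no definitions, no named facts)

* THE SUPER-PARABOLIC SIDE KILLS SWIRL (drifting form of census hook H4): `c_u ≤ −a < 0`, ratio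
  `≤ γ′ < ½`, and rescaled circulation `(C_u/C_l²)(τ) G(t(τ), x_τ) ≥ m > 0` at tracked points
  (`G = |Γ|`) ⇒ `G(t(τ), x_τ) ≥ m C_u(τ)^{2γ′−1} ≥ m e^{a(1−2γ′)τ}`, so `sup_x G(s, x)` exceeds
  every bound at some `s ∈ [0, T)` (`swirl_unbounded_of_rescaling_of_lt_half`); for a classical
  axisymmetric Navier–Stokes solution on `[0, T)` bounded on earlier slabs with `|Γ₀| ≤ M₀`
  this contradicts the swirl maximum principle `abs_swirl_le_of_classical_Ico`
  (`false_of_rescaling_of_lt_half_of_axisymmetric`).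
* RESCALED VISCOSITY: `ν C_u^{1−2γ} ≤ ν̃` for ratio `≥ γ`, `ν̃ ≤ ν C_u^{1−2γ′}` for ratio
  `≤ γ′`, `ν̃ ≡ ν` for ratio `≡ ½`; hence `ν̃ → +∞` as `τ → ∞` for ratio `≥ γ > ½` with
  `c_u ≤ −a < 0` (drifting form of `tendsto_effectiveViscosity_atTop_of_half_lt`, the census hook
  named in the zone's KILL sentence) and `ν̃ → 0` for ratio `≤ γ′ < ½`
  (`mul_rpow_clockFactor_le_rescaledViscosity`, `rescaledViscosity_le_mul_rpow_clockFactor`,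
  `rescaledViscosity_eq_of_ratio_half`, `tendsto_rescaledViscosity_atTop_of_half_lt`,
  `tendsto_rescaledViscosity_zero_of_lt_half`).

## WHAT THIS IS NOT
Real-variable bookkeeping plus one composition with a kernel theorem (the swirl maximum
principle); no profile is constructed, no existence or blow-up is asserted, nothing is claimed
about any computed trajectory.
-/

noncomputable section

open MeasureTheory Set Filter Function intervalIntegral
open _root_.Topology

namespace Literature.Analysis.FluidPDE

/-! ### The super-parabolic side: a ratio pinned below `½` makes the circulation unbounded -/

section Swirl

variable {cu cl : ℝ → ℝ}

/-- **Unbounded circulation for a ratio pinned below `γ′ < ½`** (drifting-exponent form of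
`swirl_unbounded_of_lt_half`). Let `c_u ≤ −a < 0` and `c_l ≤ γ′ (−c_u)` on `[0, ∞)` with `γ′ < ½`,
and let a size functional `G` (e.g. `G(s, x) = |Γ(s, x)|`, `Γ = r u^θ`) have a rescaled profile in
the CIRCULATION normalisation that stays nontrivial at tracked points:
`m ≤ (C_u/C_l²)(τ) G(t(τ), x_τ)` for all `τ ≥ 0`, `m > 0` (`Γ̃ = ξ²ũ₁ = (C_u/C_l²) Γ`). Then
`G(t(τ), x_τ) ≥ m C_u(τ)^{2γ′−1} ≥ m e^{a(1−2γ′)τ}`, so `G` exceeds every bound at some physical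
time `s ∈ [0, T)`. [cite: Hou2026, §3 (rescaled profiles; remark that total circulation
conservation forces c_l → 1/2)] -/
theorem swirl_unbounded_of_rescaling_of_lt_half (hcu : Continuous cu) (hcl : Continuous cl)
    {a : ℝ} (ha : 0 < a) (hca : ∀ s, 0 ≤ s → cu s ≤ -a) {γ' : ℝ} (hγ' : γ' < 1 / 2)
    (hratio : ∀ s, 0 ≤ s → cl s ≤ γ' * (-cu s)) {X : Type*} {G : ℝ → X → ℝ} {m : ℝ} (hm : 0 < m)
    (hG : ∀ τ, 0 ≤ τ → ∃ x, m ≤ rescalingFactor cu τ / rescalingFactor (fun s => -cl s) τ ^ 2 *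
      G (rescaledTime (rescalingFactor cu) τ) x) (K : ℝ) :
    ∃ s ∈ Ico 0 (blowupTime (rescalingFactor cu)), ∃ x, K < G s x := by
  -- choose `τ ≥ 0` with `m · e^{a(1−2γ′)τ} > K`
  have hL : 0 < a * (1 - 2 * γ') := mul_pos ha (by linarith)
  set τ : ℝ := |K| / (m * (a * (1 - 2 * γ'))) with hτdef
  have hτ : 0 ≤ τ := div_nonneg (abs_nonneg K) (mul_pos hm hL).le
  obtain ⟨x, hx⟩ := hG τ hτ
  have hCu := rescalingFactor_pos cu τ
  have hCl := rescalingFactor_pos (fun s => -cl s) τ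
  refine ⟨rescaledTime (rescalingFactor cu) τ,
    ⟨rescaledTime_nonneg (continuous_rescalingFactor hcu) (rescalingFactor_pos cu) hτ,
      rescaledTime_lt_blowupTime (continuous_rescalingFactor hcu) (rescalingFactor_pos cu)
        (integrableOn_rescalingFactor hcu ha hca) τ⟩, x, ?_⟩
  -- `G ≥ m C_l² / C_u`
  have h1 : m * (rescalingFactor (fun s => -cl s) τ ^ 2 / rescalingFactor cu τ) ≤
      G (rescaledTime (rescalingFactor cu) τ) x := by
    rw [mul_div_assoc'] -- m * C_l^2 / C_u ≤ G
    rw [div_le_iff₀ hCu]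
    have := hx
    rw [div_mul_eq_mul_div, le_div_iff₀ (pow_pos hCl 2)] at this
    linarith
  -- `C_l² / C_u ≥ C_u^{2γ′} / C_u = C_u^{2γ′−1} ≥ (e^{−aτ})^{2γ′−1} = e^{a(1−2γ′)τ} ≥ 1 + a(1−2γ′)τ`
  have h2 : rescalingFactor cu τ ^ (2 * γ' - 1) ≤
      rescalingFactor (fun s => -cl s) τ ^ 2 / rescalingFactor cu τ := by
    rw [Real.rpow_sub hCu, Real.rpow_one]
    refine div_le_div_of_nonneg_right ?_ hCu.le
    have h := rpow_clockFactor_le_lengthFactor hcu hcl hratio hτ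
    have h' : rescalingFactor cu τ ^ (2 * γ') = (rescalingFactor cu τ ^ γ') ^ 2 := by
      rw [mul_comm, Real.rpow_mul hCu.le, Real.rpow_two]
    rw [h']
    exact pow_le_pow_left₀ (Real.rpow_nonneg hCu.le _) h 2
  have h3 : Real.exp (a * (1 - 2 * γ') * τ) ≤ rescalingFactor cu τ ^ (2 * γ' - 1) := by
    have hle := rescalingFactor_le_exp_neg hcu hca hτ
    have : Real.exp (a * (1 - 2 * γ') * τ) = Real.exp (-a * τ) ^ (2 * γ' - 1) := by
      rw [← Real.exp_mul]; congr 1; ring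
    rw [this]
    exact Real.rpow_le_rpow_of_nonpos hCu hle (by linarith)
  have h4 : |K| + m ≤ m * Real.exp (a * (1 - 2 * γ') * τ) := by
    have h5 : a * (1 - 2 * γ') * τ + 1 ≤ Real.exp (a * (1 - 2 * γ') * τ) := Real.add_one_le_exp _
    have hLne : m * (a * (1 - 2 * γ')) ≠ 0 := (mul_pos hm hL).ne'
    have h6 : m * (a * (1 - 2 * γ')) * τ = |K| := by
      rw [hτdef, mul_div_cancel₀ _ hLne]
    have h7 : m * (a * (1 - 2 * γ') * τ + 1) ≤ m * Real.exp (a * (1 - 2 * γ') * τ) :=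
      mul_le_mul_of_nonneg_left h5 hm.le
    have h8 : m * (a * (1 - 2 * γ') * τ + 1) = |K| + m := by
      calc m * (a * (1 - 2 * γ') * τ + 1) = m * (a * (1 - 2 * γ')) * τ + m := by ring
        _ = |K| + m := by rw [h6]
    linarith
  have hK : K ≤ |K| := le_abs_self K
  calc K < |K| + m := by linarith
    _ ≤ m * Real.exp (a * (1 - 2 * γ') * τ) := h4
    _ ≤ m * rescalingFactor cu τ ^ (2 * γ' - 1) := mul_le_mul_of_nonneg_left h3 hm.le
    _ ≤ m * (rescalingFactor (fun s => -cl s) τ ^ 2 / rescalingFactor cu τ) :=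
        mul_le_mul_of_nonneg_left h2 hm.le
    _ ≤ G (rescaledTime (rescalingFactor cu) τ) x := h1

/-- **The super-parabolic side is empty for axisymmetric Navier–Stokes with bounded initial swirl**
(drifting-exponent form of census hook H4): with `ν > 0`, exponents as in
`swirl_unbounded_of_rescaling_of_lt_half` (`γ′ < ½`), a classical solution `(u, p)` of the unforced
system on `[0, T)`, `T = t(∞)`, axisymmetric at every time, bounded on every sub-slab `[0, T'] × ℝ³`
(`T' < T`), with `|Γ(0, ·)| ≤ M₀`, cannot have rescaled circulation `(C_u/C_l²)(τ) |Γ(t(τ), x_τ)| ≥ m > 0`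
at tracked points for all `τ ≥ 0`: the swirl maximum principle `|Γ(t, x)| ≤ M₀` on `[0, T)`
(`abs_swirl_le_of_classical_Ico`, Chae–Lee 2002 / KNSS 2009 (1.9)) is violated.
[cite: KochNadirashviliSereginSverak2009, §1 (1.8)–(1.9) (arXiv p. 2)] -/
theorem false_of_rescaling_of_lt_half_of_axisymmetric {ν : ℝ} (hν : 0 < ν) (hcu : Continuous cu)
    (hcl : Continuous cl) {a : ℝ} (ha : 0 < a) (hca : ∀ s, 0 ≤ s → cu s ≤ -a) {γ' : ℝ}
    (hγ' : γ' < 1 / 2) (hratio : ∀ s, 0 ≤ s → cl s ≤ γ' * (-cu s))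
    {u : ℝ → EuclideanSpace ℝ (Fin 3) → EuclideanSpace ℝ (Fin 3)}
    {p : ℝ → EuclideanSpace ℝ (Fin 3) → ℝ}
    (hcls : IsClassicalNSSolutionOn (Ico 0 (blowupTime (rescalingFactor cu))) ν 0 u p)
    (haxi : ∀ t ∈ Ico 0 (blowupTime (rescalingFactor cu)), IsAxisymmetric (u t))
    (hbdd : ∀ T' < blowupTime (rescalingFactor cu), ∃ V : ℝ, ∀ t ∈ Icc 0 T', ∀ x, ‖u t x‖ ≤ V)
    {M₀ : ℝ} (hM₀ : ∀ x, |swirl (u 0) x| ≤ M₀) {m : ℝ} (hm : 0 < m)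
    (hG : ∀ τ, 0 ≤ τ → ∃ x, m ≤ rescalingFactor cu τ / rescalingFactor (fun s => -cl s) τ ^ 2 *
      |swirl (u (rescaledTime (rescalingFactor cu) τ)) x|) : False := by
  obtain ⟨s, hs, x, hx⟩ := swirl_unbounded_of_rescaling_of_lt_half hcu hcl ha hca hγ' hratio hm
    (G := fun s x => |swirl (u s) x|) hG M₀
  exact (not_le.2 hx) (abs_swirl_le_of_classical_Ico hν hcls haxi hbdd hM₀ s hs x)

end Swirl

/-! ### The rescaled (effective) viscosity `ν̃ = ν C_u / C_l²` along the clock -/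

section Viscosity

variable {cu cl : ℝ → ℝ}

/-- **Ratio pinned above `γ`:** `ν C_u(τ)^{1−2γ} ≤ ν̃(τ) = ν C_u(τ)/C_l(τ)²` for `τ ≥ 0`, `ν ≥ 0`
(`C_l ≤ C_u^γ`). [cite: Hou2026, §3 (ν C_ψ/C_lz = ν₀: the rescaled viscosity), p. 11] -/
theorem mul_rpow_clockFactor_le_rescaledViscosity (hcu : Continuous cu) (hcl : Continuous cl)
    {γ : ℝ} (hratio : ∀ s, 0 ≤ s → γ * (-cu s) ≤ cl s) {ν : ℝ} (hν : 0 ≤ ν) {τ : ℝ} (hτ : 0 ≤ τ) :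
    ν * rescalingFactor cu τ ^ (1 - 2 * γ) ≤
      ν * rescalingFactor cu τ / rescalingFactor (fun s => -cl s) τ ^ 2 := by
  have hCu := rescalingFactor_pos cu τ
  have hCl := rescalingFactor_pos (fun s => -cl s) τ
  rw [mul_div_assoc]
  refine mul_le_mul_of_nonneg_left ?_ hν
  rw [le_div_iff₀ (pow_pos hCl 2)]
  have h := lengthFactor_le_rpow_clockFactor hcu hcl hratio hτ
  have h2 : rescalingFactor (fun s => -cl s) τ ^ 2 ≤ rescalingFactor cu τ ^ (2 * γ) := by
    rw [mul_comm, Real.rpow_mul hCu.le, Real.rpow_two]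
    exact pow_le_pow_left₀ hCl.le h 2
  calc rescalingFactor cu τ ^ (1 - 2 * γ) * rescalingFactor (fun s => -cl s) τ ^ 2
      ≤ rescalingFactor cu τ ^ (1 - 2 * γ) * rescalingFactor cu τ ^ (2 * γ) :=
        mul_le_mul_of_nonneg_left h2 (Real.rpow_nonneg hCu.le _)
    _ = rescalingFactor cu τ := by
        rw [← Real.rpow_add hCu]; norm_num

/-- **Ratio pinned below `γ′`:** `ν̃(τ) = ν C_u(τ)/C_l(τ)² ≤ ν C_u(τ)^{1−2γ′}` for `τ ≥ 0`, `ν ≥ 0`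
(`C_u^{γ′} ≤ C_l`). [cite: Hou2026, §3 (ν C_ψ/C_lz = ν₀: the rescaled viscosity), p. 11] -/
theorem rescaledViscosity_le_mul_rpow_clockFactor (hcu : Continuous cu) (hcl : Continuous cl)
    {γ' : ℝ} (hratio : ∀ s, 0 ≤ s → cl s ≤ γ' * (-cu s)) {ν : ℝ} (hν : 0 ≤ ν) {τ : ℝ}
    (hτ : 0 ≤ τ) :
    ν * rescalingFactor cu τ / rescalingFactor (fun s => -cl s) τ ^ 2 ≤
      ν * rescalingFactor cu τ ^ (1 - 2 * γ') := by
  have hCu := rescalingFactor_pos cu τ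
  have hCl := rescalingFactor_pos (fun s => -cl s) τ
  rw [mul_div_assoc]
  refine mul_le_mul_of_nonneg_left ?_ hν
  rw [div_le_iff₀ (pow_pos hCl 2)]
  have h := rpow_clockFactor_le_lengthFactor hcu hcl hratio hτ
  have h2 : rescalingFactor cu τ ^ (2 * γ') ≤ rescalingFactor (fun s => -cl s) τ ^ 2 := by
    rw [mul_comm, Real.rpow_mul hCu.le, Real.rpow_two]
    exact pow_le_pow_left₀ (Real.rpow_nonneg hCu.le _) h 2
  calc rescalingFactor cu τ = rescalingFactor cu τ ^ (1 - 2 * γ') * rescalingFactor cu τ ^ (2 * γ') := by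
        rw [← Real.rpow_add hCu]; norm_num
    _ ≤ rescalingFactor cu τ ^ (1 - 2 * γ') * rescalingFactor (fun s => -cl s) τ ^ 2 :=
        mul_le_mul_of_nonneg_left h2 (Real.rpow_nonneg hCu.le _)

/-- **Ratio exactly `½`:** if `c_l = ½ (−c_u)` identically then `ν̃ ≡ ν` (`C_l² = C_u`): the only
ratio at which a constant physical viscosity stays constant in the rescaled frame (drifting form of
`effectiveViscosity_half`). [cite: Hou2026, §3 (ν C_ψ/C_lz = ν₀; "we expect c_l → 1/2"), p. 11] -/
theorem rescaledViscosity_eq_of_ratio_half (hratio : ∀ s, cl s = 1 / 2 * (-cu s)) (ν τ : ℝ) :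
    ν * rescalingFactor cu τ / rescalingFactor (fun s => -cl s) τ ^ 2 = ν := by
  have hCu := rescalingFactor_pos cu τ
  have h := lengthFactor_eq_rpow_clockFactor hratio τ
  have h2 : rescalingFactor (fun s => -cl s) τ ^ 2 = rescalingFactor cu τ := by
    rw [h, ← Real.rpow_natCast, ← Real.rpow_mul hCu.le]; norm_num
  rw [h2, mul_div_assoc, div_self hCu.ne', mul_one]

/-- **`ν̃ → +∞` for a ratio pinned above `γ > ½`** (drifting form of
`tendsto_effectiveViscosity_atTop_of_half_lt`, the census hook named in the zone's KILL sentence):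
with `c_u ≤ −a < 0`, `γ (−c_u) ≤ c_l` on `[0, ∞)` and `ν > 0`, `ν C_u(τ)/C_l(τ)² → +∞` as `τ → ∞`
(indeed `≥ ν e^{a(2γ−1)τ}`): diffusion is not a perturbation along such a clock.
[cite: Hou2026, §3 (ν C_ψ/C_lz = ν₀: the rescaled viscosity), p. 11] -/
theorem tendsto_rescaledViscosity_atTop_of_half_lt (hcu : Continuous cu) (hcl : Continuous cl)
    {a : ℝ} (ha : 0 < a) (hca : ∀ s, 0 ≤ s → cu s ≤ -a) {γ : ℝ} (hγ : 1 / 2 < γ)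
    (hratio : ∀ s, 0 ≤ s → γ * (-cu s) ≤ cl s) {ν : ℝ} (hν : 0 < ν) :
    Tendsto (fun τ => ν * rescalingFactor cu τ / rescalingFactor (fun s => -cl s) τ ^ 2)
      atTop atTop := by
  have hexp : Tendsto (fun τ => ν * Real.exp (a * (2 * γ - 1) * τ)) atTop atTop :=
    (Real.tendsto_exp_atTop.comp (tendsto_id.const_mul_atTop (mul_pos ha (by linarith)))).const_mul_atTop hν
  refine tendsto_atTop_mono' atTop ?_ hexp
  filter_upwards [eventually_ge_atTop (0 : ℝ)] with τ hτ
  have hCu := rescalingFactor_pos cu τ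
  refine le_trans ?_ (mul_rpow_clockFactor_le_rescaledViscosity hcu hcl hratio hν.le hτ)
  refine mul_le_mul_of_nonneg_left ?_ hν.le
  have hle := rescalingFactor_le_exp_neg hcu hca hτ
  have : Real.exp (a * (2 * γ - 1) * τ) = Real.exp (-a * τ) ^ (1 - 2 * γ) := by
    rw [← Real.exp_mul]; congr 1; ring
  rw [this]
  exact Real.rpow_le_rpow_of_nonpos hCu hle (by linarith)

/-- **`ν̃ → 0` for a ratio pinned below `γ′ < ½`** (drifting form of
`tendsto_effectiveViscosity_zero_of_lt_half`): with `c_u ≤ −a < 0`, `c_l ≤ γ′ (−c_u)` on `[0, ∞)`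
and `ν ≥ 0`, `ν C_u(τ)/C_l(τ)² → 0` as `τ → ∞` (`≤ ν e^{−a(1−2γ′)τ}`): the inviscid side.
[cite: Hou2026, §3 (ν C_ψ/C_lz = ν₀: the rescaled viscosity), p. 11] -/
theorem tendsto_rescaledViscosity_zero_of_lt_half (hcu : Continuous cu) (hcl : Continuous cl)
    {a : ℝ} (ha : 0 < a) (hca : ∀ s, 0 ≤ s → cu s ≤ -a) {γ' : ℝ} (hγ' : γ' < 1 / 2)
    (hratio : ∀ s, 0 ≤ s → cl s ≤ γ' * (-cu s)) {ν : ℝ} (hν : 0 ≤ ν) :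
    Tendsto (fun τ => ν * rescalingFactor cu τ / rescalingFactor (fun s => -cl s) τ ^ 2)
      atTop (𝓝 0) := by
  have hexp : Tendsto (fun τ => ν * Real.exp (-(a * (1 - 2 * γ')) * τ)) atTop (𝓝 0) := by
    have h := (Real.tendsto_exp_neg_atTop_nhds_zero.comp
      (tendsto_id.const_mul_atTop (mul_pos ha (by linarith : (0 : ℝ) < 1 - 2 * γ')))).const_mul ν
    rw [mul_zero] at h
    refine h.congr' (Eventually.of_forall fun τ => ?_)
    simp only [Function.comp_apply, id, neg_mul]
  refine squeeze_zero' ?_ ?_ hexp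
  · filter_upwards with τ
    exact div_nonneg (mul_nonneg hν (rescalingFactor_pos cu τ).le) (pow_nonneg (rescalingFactor_pos _ τ).le 2)
  · filter_upwards [eventually_ge_atTop (0 : ℝ)] with τ hτ
    have hCu := rescalingFactor_pos cu τ
    refine (rescaledViscosity_le_mul_rpow_clockFactor hcu hcl hratio hν hτ).trans ?_
    refine mul_le_mul_of_nonneg_left ?_ hν
    have hle := rescalingFactor_le_exp_neg hcu hca hτ
    have : Real.exp (-(a * (1 - 2 * γ')) * τ) = Real.exp (-a * τ) ^ (1 - 2 * γ') := by
      rw [← Real.exp_mul]; congr 1; ring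
    rw [this]
    exact Real.rpow_le_rpow hCu.le hle (by linarith)

end Viscosity

end Literature.Analysis.FluidPDE

end
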